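import Summits.NavierStokesRegularity.NavierStokesRegularity.Theorems.FilamentSkeletonRssSkeletonJ1RSplit
import Summits.NavierStokesRegularity.NavierStokesRegularity.Theorems.FilamentSkeletonRssNormalBlockMatchedL
import Summits.NavierStokesRegularity.NavierStokesRegularity.Theorems.FilamentSkeletonRssClause13RImp

/-!
# Route `FilamentSkeletonRss` · crux `SkeletonJ1R` (stmt-NavierStokesRegularity-23610) · BC3 SKELETON OF RECORD, line `near_straight_newton_R` (v1)

Variant A1R (clause 13-J ↦ 13-R retype; director-ns dss_114/dss_115, idea-crit-7 stamp 2026-08-28T22:03:57Z, tenure ns-filament-repair-plan g26,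
route revs 53/54/55).  This is the R-twin of the v2-slim skeleton of record of the superseded parent `SkeletonJ1L` (stmt-23296,
`filament-plan/lines/SkeletonJ1L/near_straight_newton_L.lean`, sha256 542f85c6…): the SAME decomposition «tangent piece ∧ clause piece ∧ normal block
⟹ parent», with the clause piece now carrying 13-R (the in-ball clause-13 operator BORDERED by the rotation-rate column, conjunct `|dα| * √Γ ≤ cnd * L`;
rate conjunct calibrated to a = 0 — crit-7 PR-1, lane 19175-p1 g14 2026-08-28T22:09:23Z).

REGISTERED STUBS = the two OPEN pieces, BY NAME (route decls): `stub_tangentSkeletonL : TangentSkeletonNearStraightL` (stmt-23320, XL; its own skeleton of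
record `filament-plan/lines/TangentSkeletonNearStraightL/child_tangent_analytic_strip_L.lean` b0b56c52…: `stub_stripPropagation` OPEN, `stub_analyticClosingL`
OPEN, `stub_liaSymbol` discharged by reference p656939) and `stub_clause13R : Clause13RNearStraightL` (stmt-23612; brick programme DESIGN-NOTE-28296 §4–§5,
twelve landed in-ball lemmas + the new bordered-column brick).  The third piece `NormalBlockMatchedL` (stmt-23322) is a THEOREM in the tree (p667604) and is
cited by name (no `sorry`); the glue `SkeletonJ1ROfNearStraightParts` (stmt-23614) is a THEOREM in the tree (lane g14, p673130, commit 7d9277fa08eb) and the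
composition below goes through its `skeletonJ1R_of_children`.  The only `sorry`s of this file are the two registered stubs.

MODEL rung, NEGATIVE side of the ladder: a skeleton registration; nothing here proves or refutes any item; NS regularity is not touched.
-/

namespace Summit.NavierStokesRegularity.NavierStokesRegularity.Cruxes.SkeletonJ1R.NearStraightNewtonR

open Summit.NavierStokesRegularity.NavierStokesRegularity.Theses.FilamentSkeletonRss

/-! ## 1. Registered stubs = the OPEN pieces of `SkeletonJ1R`'s decomposition of record, BY NAME -/

/-- STUB (piece 1, stmt-NavierStokesRegularity-23320; XL, the heart; HARDEST): exactly tangent near-straight core-matched RIGID-core skeletons shadow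
every general-position straight skew datum, for every small tolerance `Rb` and all `Γ ≥ Γ₂(Rb)`; with rigid cores the waist clause `w′(c) ≥ 3/2 + δ`
must come from the OUTER STRAIN ALONE (T2 r4) — this is where the piece can fail.  Unchanged by A1R (clause-13-free). -/
theorem stub_tangentSkeletonL :
    Summit.NavierStokesRegularity.NavierStokesRegularity.Theses.FilamentSkeletonRss.TangentSkeletonNearStraightL := by
  sorry

/-- STUB (piece 2, stmt-NavierStokesRegularity-23612; M–L): clause 13-R for near-straight exactly tangent rigid-core skeletons — for every `dα, L`, an
in-ball defect bound on `DT·Y − dα·R_j` (`R_j = e₃×X_j − ⟪e₃×X_j, X_j′⟫X_j′`) forces `‖Y‖ ≤ cnd·L·(1+|τ−c_j|)^b` AND `|dα|·√Γ ≤ cnd·L` (the ∃-side OWES the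
rate row; MODEL shadow: j318115 HALF-KEEP on R_π, basis-limited).  Why it might fail: a «rate wall» (a kernel direction of the bordered operator with
`|dα|√Γ ≫ L`) on the family the ∃-side uses — word (R-b). -/
theorem stub_clause13R :
    Summit.NavierStokesRegularity.NavierStokesRegularity.Theses.FilamentSkeletonRss.Clause13RNearStraightL := by
  sorry

/-- Piece 3 (stmt-NavierStokesRegularity-23322) — DISCHARGED BY NAME: `NormalBlockMatchedL` is a theorem in the tree (lane 19175-p1 g14, p667604,
item CLOSED·PROVED 2026-08-28T20:58:49Z).  No `sorry`. -/
theorem stub_normalBlockL :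
    Summit.NavierStokesRegularity.NavierStokesRegularity.Theses.FilamentSkeletonRss.NormalBlockMatchedL :=
  Summit.NavierStokesRegularity.NavierStokesRegularity.Theorems.FilamentSkeletonRssNormalBlockMatchedL.stub_normalBlockL

/-! ## 2. Composition: the crux `SkeletonJ1R` BY NAME from the two open stubs, through the LANDED A1R split glue (p673130) -/

/-- **The skeleton's conclusion: the crux `FilamentSkeletonRss.SkeletonJ1R` (stmt-NavierStokesRegularity-23610) BY NAME.**  Real proof: the landed glue
`skeletonJ1R_of_children` applied to the two open stubs and the landed piece 3. -/
theorem SkeletonJ1R_of : Summit.NavierStokesRegularity.NavierStokesRegularity.Theses.FilamentSkeletonRss.SkeletonJ1R :=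
  Summit.NavierStokesRegularity.NavierStokesRegularity.Theorems.FilamentSkeletonRssSkeletonJ1RSplit.skeletonJ1R_of_children
    stub_tangentSkeletonL stub_clause13R stub_normalBlockL

/-- The glue item `SkeletonJ1ROfNearStraightParts` (stmt-23614) is a theorem by name (p673130) — recorded here so the registry sees the whole decomposition. -/
theorem glue_closed : Summit.NavierStokesRegularity.NavierStokesRegularity.Theses.FilamentSkeletonRss.SkeletonJ1ROfNearStraightParts :=
  Summit.NavierStokesRegularity.NavierStokesRegularity.Theorems.FilamentSkeletonRssSkeletonJ1RSplit.skeletonJ1ROfNearStraightParts_holds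

/-- By-name record (A1R lemma file, LEAD/lane port `Theorems/FilamentSkeletonRssClause13RImp.lean`): the R-parent implies the superseded L-parent. -/
theorem skeletonJ1L_of_R (h : Summit.NavierStokesRegularity.NavierStokesRegularity.Theses.FilamentSkeletonRss.SkeletonJ1R) :
    Summit.NavierStokesRegularity.NavierStokesRegularity.Theses.FilamentSkeletonRss.SkeletonJ1L :=
  Summit.NavierStokesRegularity.NavierStokesRegularity.Theorems.skeletonJ1R_imp_skeletonJ1L h

end Summit.NavierStokesRegularity.NavierStokesRegularity.Cruxes.SkeletonJ1R.NearStraightNewtonR
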